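import Literature.AnabelianGeometry.EtaleTheta.CompatibleRootSystems
import Literature.NumberTheory.GaloisRepresentations.GaloisCohomology
import Mathlib.FieldTheory.IsAlgClosed.Basic
import Mathlib.RingTheory.RootsOfUnity.Basic

/-!
# Kummer injectivity for unit groups of fields: `((k̄)ˣ)^H → H¹(H, Λ((k̄)ˣ))`

The abstract Kummer-injectivity criterion `kummerMapFixed_injective_iff_of_finite_torsion`
(`EtaleTheta/CompatibleRootSystems.lean`: for `A^H` with finite `n`-torsion, the Kummer map
`A^H → H¹(H, Λ(A))` of [cite: LANA2026Report, §6.1 p.31] is injective iff `⋂_N (A^H)^N = 1`)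
specialised to the case the anabelian sources care about, `A = (k̄)ˣ` with a (Galois) group acting
([AbsTopIII] Def. 1.5 (b), "the associated Kummer map `A(k_H) → H¹(H, Hom(ℚ/ℤ, A(k̄)))` is an
injection", here for tori, `A = 𝔾_m`). What this file supplies (requested by abc-iut-L4-t1 for
`AbsoluteAnabelian/AbsTopIII/KummerFaithful.lean`):

* `rootableByUnitsOfIsAlgClosed` — the unit group of an algebraically closed field is rootable
  (`n`-th roots of units, `IsAlgClosed.exists_pow_nat_eq`), registered as an instance for
  `(AlgebraicClosure k)ˣ` (hypothesis (a) of the LANA Kummer map; no Mathlib instance exists);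
* `finite_setOf_pow_eq_one_invariants` — for a domain `R`, the `n`-torsion of `(Rˣ)^H` is finite
  (it embeds in `rootsOfUnity n R`);
* `kummerMapFixed_injective_iff_units` — the criterion for `A = Rˣ`, `R` a domain with `Rˣ` rootable,
  and `kummerMapFixed_injective_iff_absoluteGaloisGroup` — for `Γ_k = Field.absoluteGaloisGroup k`
  acting on `(k̄)ˣ` through the tree's `Field.absoluteGaloisGroup.instMulDistribMulActionUnits`
  (`GaloisRepresentations/GaloisCohomology.lean`) and ANY subgroup `H ≤ Γ_k`.

Universe: Mathlib's `Rep ℤ G` forces the cohomological statements into `Type` (so `k : Type`).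
Everything is proved.
-/

namespace Literature.AnabelianGeometry.EtaleTheta

/-! ### Units of an algebraically closed field are rootable -/

section AlgClosed

variable (F : Type*) [Field F] [IsAlgClosed F]

/-- In an algebraically closed field every unit has an `n`-th root for every `n ≥ 1`
(`IsAlgClosed.exists_pow_nat_eq`); packaged as a `RootableBy Fˣ ℕ` structure (with the Mathlib
convention `root u 0 = 1`). A reducible definition, registered as an instance for algebraic closures
below — hypothesis (a) "`n`-divisibility" of [cite: LANA2026Report, §6.1 p.31]. -/
@[reducible] noncomputable def rootableByUnitsOfIsAlgClosed : RootableBy Fˣ ℕ where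
  root u n := if hn : n = 0 then 1 else
    Units.mk0 (Classical.choose (IsAlgClosed.exists_pow_nat_eq (u : F) (Nat.pos_of_ne_zero hn)))
      (by
        intro h0
        have h := Classical.choose_spec (IsAlgClosed.exists_pow_nat_eq (u : F) (Nat.pos_of_ne_zero hn))
        rw [h0, zero_pow hn] at h
        exact u.ne_zero h.symm)
  root_zero u := by simp
  root_cancel {n} u hn := by
    ext
    simp only [dif_neg hn, Units.val_pow_eq_pow_val, Units.val_mk0]
    exact Classical.choose_spec (IsAlgClosed.exists_pow_nat_eq (u : F) (Nat.pos_of_ne_zero hn))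

/-- The unit group of an algebraic closure is rootable. [cite: LANA2026Report, §6.1 p.31] -/
noncomputable instance instRootableByUnitsAlgebraicClosure (k : Type*) [Field k] :
    RootableBy (AlgebraicClosure k)ˣ ℕ :=
  rootableByUnitsOfIsAlgClosed (AlgebraicClosure k)

end AlgClosed

/-! ### Finite torsion of invariants in unit groups of domains -/

section Domain

variable {G : Type} [Group G] {R : Type} [CommRing R] [IsDomain R] [MulDistribMulAction G Rˣ]
  (H : Subgroup G)

/-- The `n`-torsion of `(Rˣ)^H` is finite for a domain `R` (it embeds into `μ_n(R)`, which has at most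
`n` elements) — the finiteness hypothesis of `kummerMapFixed_injective_iff_of_finite_torsion`.
[cite: MochizukiAbsTopIII2015, Def 1.5 p.32] -/
theorem finite_setOf_pow_eq_one_invariants (n : ℕ+) :
    Set.Finite {x : invariants (A := Rˣ) H | x ^ (n : ℕ) = 1} := by
  haveI : NeZero (n : ℕ) := ⟨n.ne_zero⟩
  have hf : Finite {x : invariants (A := Rˣ) H // x ^ (n : ℕ) = 1} := by
    refine Finite.of_injective
      (fun x => (⟨((x.1 : invariants (A := Rˣ) H) : Rˣ), (mem_rootsOfUnity _ _).2 (by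
        have h := congrArg (fun y : invariants (A := Rˣ) H => (y : Rˣ)) x.2
        simpa using h)⟩ : rootsOfUnity n R)) ?_
    intro x y hxy
    have h := congrArg (fun z : rootsOfUnity n R => (z : Rˣ)) hxy
    exact Subtype.ext (Subtype.ext h)
  exact Set.finite_coe_iff.mp hf

/-- **Kummer injectivity for unit groups** ([AbsTopIII] Def. 1.5 (a) ⟺ (b) for `𝔾_m`): for a group
`G` acting on the units of a domain `R` with `Rˣ` rootable and any subgroup `H`, the Kummer map
`(Rˣ)^H → H¹(H, Λ(Rˣ))` of [cite: LANA2026Report, §6.1 p.31] is injective iff no `a ≠ 1` in `(Rˣ)^H`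
has an `n`-th root in `(Rˣ)^H` for every `n ≥ 1`. -/
theorem kummerMapFixed_injective_iff_units [RootableBy Rˣ ℕ] :
    Function.Injective (kummerMapFixed (A := Rˣ) H) ↔
      ∀ a : invariants (A := Rˣ) H,
        (∀ n : ℕ+, ∃ b : invariants (A := Rˣ) H, b ^ (n : ℕ) = a) → a = 1 :=
  kummerMapFixed_injective_iff_of_finite_torsion H (finite_setOf_pow_eq_one_invariants H)

end Domain

/-! ### The absolute Galois group acting on `(k̄)ˣ` -/

section Galois

/-- **[AbsTopIII] Def. 1.5 (b) for tori, Kummer side**: for a field `k`, its absolute Galois group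
`Γ_k` acting on `(k̄)ˣ` (the tree's `Field.absoluteGaloisGroup.instMulDistribMulActionUnits`) and ANY
subgroup `H ≤ Γ_k`, the Kummer map `((k̄)ˣ)^H → H¹(H, Λ((k̄)ˣ))` is injective iff
`⋂_N (((k̄)ˣ)^H)^N = 1`. (For `H` open, `((k̄)ˣ)^H = (k_H)ˣ` for the finite extension `k_H` — the Galois
correspondence step is abc-iut-L4-t1's.) [cite: MochizukiAbsTopIII2015, Def 1.5 p.32] -/
theorem kummerMapFixed_injective_iff_absoluteGaloisGroup (k : Type) [Field k]
    (H : Subgroup (Field.absoluteGaloisGroup k)) :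
    Function.Injective (kummerMapFixed (A := (AlgebraicClosure k)ˣ) H) ↔
      ∀ a : invariants (A := (AlgebraicClosure k)ˣ) H,
        (∀ n : ℕ+, ∃ b : invariants (A := (AlgebraicClosure k)ˣ) H, b ^ (n : ℕ) = a) → a = 1 :=
  kummerMapFixed_injective_iff_units H

end Galois

end Literature.AnabelianGeometry.EtaleTheta
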